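import Summits.AtomisticToContinuum.FouriersLaw.Theses.EmbeddedDrudeMourre
import Summits.AtomisticToContinuum.FouriersLaw.Theorems.EmbeddedDrudeMourreGreenKuboContinuationThermalFamily
import HarnessLib

/-!
# `GreenKuboContinuation` (stmt-AtomisticToContinuum-12597) from the CANONICAL all-`T` Abelian Green–Kubo limit

`--supports` file of the continuation lead c5 (2026-08-16). The three checked lines of the crux
(`temperature-blind-vitali-hurwitz`, `heated-measure-thermal-exponent`, `overlap-rigidity-analytic-continuation`)
were all judged `line-dead` this session for the same reason: each relocates, into one ν-uniform
hypothesis or import slot, the statement below — the Abel limit of the CANONICAL pair of the pinned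
anharmonic chain at every temperature — which is the crux's entire content once the identification seam
is removed (c3 `Restatement.lean`) and which no engine in print or in the tree supplies.

This file types that residual ONCE, in the tree's vocabulary and without new definitions, and certifies
that it closes the crux AS FILED (the corner hypothesis is discarded, so no retype is even needed on this
side): `greenKuboContinuation_of_canonicalAbelLimit`. Hypothesis (`∀`-form over the canonical class; by
`thermalFamily_state_unique` and uniqueness of the flow on `bmGood` every instance is the one canonical
pair): for every dynamics `D` of `pinnedChain ω₂ lam β γ` with `D.carrier = bmGood` and every `T > 0`,
every shift-invariant DLR state `μ` at `T` preserved by `D` has a positive finite Abel limit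
`T⁻² ∫₀^∞ e^{-νt} C_{D,μ}(t) dt → κ > 0`. Everything else the witness clause asks (existence of such
`(D, μ)` at every `T`, absolute convergence of `C`) is PROVED (`thermalFamily`, p108267). Together with
`greenKuboContinuation_of_fourierGreenKubo` (p115442: stmt-0703 ⇒ crux) this gives the planner the two
honest upstream items for the import slot: stmt-0703 (`L¹` form) or the canonical Abelian statement below
(weaker: implied by 0703 via `HasGreenKubo.tendsto_abel` only when 0703's pair is the canonical one).
-/

noncomputable section

namespace Summit.AtomisticToContinuum.FouriersLaw.Theorems.GreenKuboContinuation

open Filter Topology MeasureTheory Set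
open Literature.MathematicalPhysics.KineticTheory.HeatConduction

/-- **The canonical all-`T` Abelian Green–Kubo limit closes the crux.** If for `pinnedChain ω₂ lam β γ`
(all `> 0`), every dynamics `D` with carrier `bmGood`, every `T > 0` and every shift-invariant DLR state
`μ` at `T` preserved by `D`, the Abel-regularised Green–Kubo functional `T⁻² ∫₀^∞ e^{-νt} C_{D,μ}(t) dt`
converges to some `κ > 0` as `ν ↓ 0`, then `EmbeddedDrudeMourre.GreenKuboContinuation` holds — the
regular thermal family (`thermalFamily`: BM flow + transfer-operator Gibbs states, absolutely convergent
correlations) is the witness at every `T`, and the corner hypothesis of the crux is not used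
(cf. `greenKuboContinuation_of_abelWitnessAllT`, p115442). [folklore] -/
theorem greenKuboContinuation_of_canonicalAbelLimit :
    (∀ ω₂ lam β γ : ℝ, 0 < ω₂ → 0 < lam → 0 < β → 0 < γ → ∀ (D : InfiniteChainDynamics (pinnedChain ω₂ lam β γ)), D.carrier = (pinnedChain ω₂ lam β γ).bmGood → ∀ T : ℝ, 0 < T → ∀ μ : Measure ChainConfig, (pinnedChain ω₂ lam β γ).IsChainGibbsMeasure T μ → IsShiftInvariant μ → D.PreservesMeasure μ → ∃ κ : ℝ, 0 < κ ∧ Tendsto (fun ν : ℝ => (T ^ 2)⁻¹ * ∫ t in Ioi (0 : ℝ), Real.exp (-(ν * t)) * D.currentCorrelation μ t) (𝓝[>] (0 : ℝ)) (𝓝 κ)) → Summit.AtomisticToContinuum.FouriersLaw.Theses.EmbeddedDrudeMourre.GreenKuboContinuation := by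
  intro h
  unfold Summit.AtomisticToContinuum.FouriersLaw.Theses.EmbeddedDrudeMourre.GreenKuboContinuation
  intro ω₂ lam β γ hω hl hβ hγ _T₀ _hT₀ _hcorner T hT
  obtain ⟨μ, D, hcar, hfam⟩ := TemperatureBlindVitaliHurwitz.thermalFamily ω₂ lam β γ hω hl hβ hγ
  obtain ⟨hG, hS, -, hP, hAC, -⟩ := hfam T hT
  obtain ⟨κ, hκ, hlim⟩ := h ω₂ lam β γ hω hl hβ hγ D hcar T hT (μ T) hG hS hP
  exact ⟨μ T, D, κ, hG, hP, hAC, hκ, hlim⟩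

end Summit.AtomisticToContinuum.FouriersLaw.Theorems.GreenKuboContinuation

end
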